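import Summits.FinalStateConjecture.FinalStateConjecture.Theorems.EIHFluxBalanceInertialRecessionRechartCarterTimeRaising

/-!
# Route EIHFluxBalance — `InertialRecession`, re-charting: the LAB CLOCK `θ = T₀⁻¹` of a clock chart
# and the SHARP time dictionary (inputs `θᵢ`, `βᵢ(·)` of the transfer …RechartTransfer3)

Helper file for the crux `stmt-FinalStateConjecture-10166`
(`Summit.FinalStateConjecture.FinalStateConjecture.Theses.EIHFluxBalance.InertialRecession`),
stub `stub_rechart` (the transfer P2 of line `sublinear-is-free-clean-window-charges`).

For the proper-time clock `T₀` of …StubRechart3Package (`τ − σ ≤ T₀ τ − T₀ σ ≤ γ(τ − σ)`):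
* `exists_labClock` — the inverse clock `θ` (`θ (T₀ τ) = τ`, `T₀ (θ t) = t`), monotone and
  `1`-Lipschitz (`θ t − θ t' ≤ t − t'` for `t' ≤ t`), so that the SLACK `t − θ t` is nondecreasing —
  the clock function `θᵢ` of `exterior_subset_certified_union_causalPast₃` for the rest-frame clock
  chart (whose model time is `y⁰ = τ`);
* `abs_clock_sub_labTime_le` — the SHARP time clause of coverage: for a chart point
  `x = honestChart Λ̃ ξ T₀ y`, `|T₀(y⁰) − x⁰| ≤ √((ũ⁰(T₀ y⁰))² − 1) ‖ỹ‖` (the discrepancy is the frame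
  tilt, `abs_frameTilt_le`; compare the crude `16γ²(R + |a|)` of `coverage_of_honest`, which does
  not vanish for a hole at rest and so cannot feed the lab-slab clause of the transfer);
* `abs_modelTime_sub_clock_le` — hence `|y⁰ − θ(x⁰)| ≤ √((ũ⁰(T₀ y⁰))² − 1) ‖ỹ‖` (`θ` is
  `1`-Lipschitz): the dictionary `hcov` of the transfer with `θᵢ = θ` and tilt `√(ũ⁰² − 1)` read at
  the hole's own clock time.
[folklore]
-/

noncomputable section

set_option linter.dupNamespace false

open Set Filter Topology Function Literature.Geometry.Lorentzian
open Summit.FinalStateConjecture.FinalStateConjecture.Theorems.SublinearIsFree.Rechart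

namespace Summit.FinalStateConjecture.FinalStateConjecture.Theorems

/-! ### The inverse clock -/

/-- **The lab clock of a bi-Lipschitz proper-time clock.** If `τ − σ ≤ T₀ τ − T₀ σ ≤ γ(τ − σ)` for
`σ ≤ τ`, then `T₀` has an inverse `θ` with `θ (T₀ τ) = τ`, `T₀ (θ t) = t`, `θ` monotone and
`1`-Lipschitz (so the slack `t − θ t` is nondecreasing). [folklore] -/
theorem exists_labClock {T₀ : ℝ → ℝ} {γ : ℝ} (hlo : ∀ σ τ, σ ≤ τ → τ - σ ≤ T₀ τ - T₀ σ)
    (hhi : ∀ σ τ, σ ≤ τ → T₀ τ - T₀ σ ≤ γ * (τ - σ)) :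
    ∃ θ : ℝ → ℝ, (∀ τ, θ (T₀ τ) = τ) ∧ (∀ t, T₀ (θ t) = t) ∧ Monotone θ ∧
      (∀ t t', t' ≤ t → θ t - θ t' ≤ t - t') ∧ Monotone (fun t ↦ t - θ t) := by
  have hsm : StrictMono T₀ := fun σ τ h ↦ by have := hlo σ τ h.le; linarith
  have hγ : 0 ≤ γ := by have h1 := hlo 0 1 zero_le_one; have h2 := hhi 0 1 zero_le_one; linarith
  -- continuity (Lipschitz)
  have hcont : Continuous T₀ := by
    refine (LipschitzWith.of_dist_le_mul (K := (⟨γ, hγ⟩ : NNReal)) fun σ τ ↦ ?_).continuous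
    rw [Real.dist_eq, Real.dist_eq]
    change |T₀ σ - T₀ τ| ≤ γ * |σ - τ|
    rcases le_total σ τ with h | h
    · rw [abs_sub_comm, abs_of_nonneg (by have := hlo σ τ h; linarith), abs_sub_comm,
        abs_of_nonneg (sub_nonneg.mpr h)]
      exact hhi σ τ h
    · rw [abs_of_nonneg (by have := hlo τ σ h; linarith), abs_of_nonneg (sub_nonneg.mpr h)]
      exact hhi τ σ h
  -- surjectivity (unbounded both ways + intermediate values)
  have hsurj : Surjective T₀ := by
    intro t
    set σ : ℝ := -(|t - T₀ 0| + 1) with hσ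
    set τ : ℝ := |t - T₀ 0| + 1 with hτ
    have h1 : T₀ σ ≤ t := by
      have := hlo σ 0 (by rw [hσ]; linarith [abs_nonneg (t - T₀ 0)])
      have := neg_abs_le (t - T₀ 0); rw [hσ] at *; linarith
    have h2 : t ≤ T₀ τ := by
      have := hlo 0 τ (by rw [hτ]; positivity)
      have := le_abs_self (t - T₀ 0); rw [hτ] at *; linarith
    have hστ : σ ≤ τ := by rw [hσ, hτ]; linarith [abs_nonneg (t - T₀ 0)]
    obtain ⟨s, -, hs⟩ := intermediate_value_Icc hστ hcont.continuousOn ⟨h1, h2⟩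
    exact ⟨s, hs⟩
  set e : ℝ ≃o ℝ := hsm.orderIsoOfSurjective T₀ hsurj with he
  have heT : ∀ τ, e τ = T₀ τ := fun τ ↦ rfl
  refine ⟨e.symm, fun τ ↦ e.symm_apply_apply τ, fun t ↦ ?_, e.symm.monotone, fun t t' htt' ↦ ?_,
    fun t' t htt' ↦ ?_⟩
  · rw [← heT, e.apply_symm_apply]
  · have h := hlo (e.symm t') (e.symm t) (e.symm.monotone htt')
    rw [← heT, ← heT, e.apply_symm_apply, e.apply_symm_apply] at h
    exact h
  · have h := hlo (e.symm t') (e.symm t) (e.symm.monotone htt')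
    rw [← heT, ← heT, e.apply_symm_apply, e.apply_symm_apply] at h
    show t' - e.symm t' ≤ t - e.symm t
    linarith

/-! ### The sharp time dictionary of the honest chart -/

/-- **Clock time versus lab time of a chart point, sharp form**: for `x = honestChart Λ ξ T₀ y`,
`|T₀(y⁰) − x⁰| ≤ √(((Λ(T₀ y⁰))e₀)⁰² − 1) ‖ỹ‖` — the discrepancy is the tilt of the rest slab, which
vanishes with the painted speed. [folklore] -/
theorem abs_clock_sub_labTime_le (Λ : ℝ → lorentzGroup) (ξ : ℝ → E3) (T₀ : ℝ → ℝ) (y : E4) :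
    |T₀ (y 0) - honestChart Λ ξ T₀ y 0| ≤
      Real.sqrt ((((Λ (T₀ (y 0)) : E4 ≃L[ℝ] E4) (E4.basisVector 0)) 0) ^ 2 - 1) * ‖E4.spatial y‖ := by
  rw [honestChart_apply_zero, clockMap, show T₀ (y 0) - (T₀ (y 0) + frameTilt (Λ (T₀ (y 0))) (E4.spatial y)) =
    -(frameTilt (Λ (T₀ (y 0))) (E4.spatial y)) by ring, abs_neg]
  exact abs_frameTilt_le (Λ (T₀ (y 0))) (E4.spatial y)

/-- **Model time versus the lab clock of the lab time, sharp form** (the dictionary `hcov` of the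
transfer for the rest-frame clock chart): with the inverse clock `θ` (`1`-Lipschitz, `θ ∘ T₀ = id`),
`|y⁰ − θ(x⁰)| ≤ √(((Λ(T₀ y⁰))e₀)⁰² − 1) ‖ỹ‖` for `x = honestChart Λ ξ T₀ y`. [folklore] -/
theorem abs_modelTime_sub_clock_le (Λ : ℝ → lorentzGroup) (ξ : ℝ → E3) (T₀ : ℝ → ℝ) {θ : ℝ → ℝ}
    (hθT : ∀ τ, θ (T₀ τ) = τ) (hθm : Monotone θ) (hθ1 : ∀ t t', t' ≤ t → θ t - θ t' ≤ t - t') (y : E4) :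
    |y 0 - θ (honestChart Λ ξ T₀ y 0)| ≤
      Real.sqrt ((((Λ (T₀ (y 0)) : E4 ≃L[ℝ] E4) (E4.basisVector 0)) 0) ^ 2 - 1) * ‖E4.spatial y‖ := by
  have h := abs_clock_sub_labTime_le Λ ξ T₀ y
  refine le_trans ?_ h
  -- `θ` is `1`-Lipschitz and `θ (T₀ y⁰) = y⁰`
  set t₁ : ℝ := T₀ (y 0)
  set t₂ : ℝ := honestChart Λ ξ T₀ y 0
  rw [← hθT (y 0)]
  rcases le_total t₂ t₁ with h12 | h12
  · rw [abs_of_nonneg (sub_nonneg.mpr (hθm h12)), abs_of_nonneg (sub_nonneg.mpr h12)]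
    exact hθ1 t₁ t₂ h12
  · rw [abs_sub_comm, abs_of_nonneg (sub_nonneg.mpr (hθm h12)), abs_sub_comm,
      abs_of_nonneg (sub_nonneg.mpr h12)]
    exact hθ1 t₂ t₁ h12

/-- A monotone `1`-Lipschitz clock in absolute-value form (registered stub `one_lipschitz_abs_rechart`
of the crux item). [folklore] -/
theorem one_lipschitz_abs_rechart : ∀ {θ : ℝ → ℝ}, Monotone θ → (∀ t t', t' ≤ t → θ t - θ t' ≤ t - t') → ∀ t t' : ℝ, |θ t - θ t'| ≤ |t - t'| :=
  fun hθm hθ1 t t' ↦ by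
    rcases le_total t' t with h | h
    · rw [abs_of_nonneg (sub_nonneg.mpr (hθm h)), abs_of_nonneg (sub_nonneg.mpr h)]; exact hθ1 t t' h
    · rw [abs_sub_comm, abs_of_nonneg (sub_nonneg.mpr (hθm h)), abs_sub_comm, abs_of_nonneg (sub_nonneg.mpr h)]
      exact hθ1 t' t h

/-! ### The lab clock is differentiable; the slack rate -/

/-- **Derivative of the lab clock.** If `T₀` has derivative `T₀' τ ≥ 1` everywhere and `θ` is its
continuous inverse (`T₀ (θ t) = t`), then `θ` has derivative `(T₀' (θ t))⁻¹` at `t`. [folklore] -/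
theorem hasDerivAt_labClock {T₀ θ T₀' : ℝ → ℝ} (hd : ∀ τ, HasDerivAt T₀ (T₀' τ) τ) (h1 : ∀ τ, 1 ≤ T₀' τ)
    (hθc : Continuous θ) (hTθ : ∀ t, T₀ (θ t) = t) (t : ℝ) :
    HasDerivAt θ (T₀' (θ t))⁻¹ t :=
  HasDerivAt.of_local_left_inverse hθc.continuousAt (hd (θ t)) (by have := h1 (θ t); positivity)
    (Eventually.of_forall hTθ)

/-- **The slack rate.** With `T₀' = ũ⁰ ∘ Λ̃ ∘ T₀ ≥ 1` (proper-time clock of an orthochronous frame) and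
`θ` the lab clock, the slack `s t = t − θ t` has derivative `1 − (ũ⁰(t))⁻¹ ≥ (ũ⁰(t) − 1)/γ` at every
lab time `t` when `ũ⁰ ≤ γ`: the input `hslack` of `exists_adapted_profile_sqrt` with modulus
`w = ũ⁰ − 1` and `c = γ⁻¹`. [folklore] -/
theorem hasDerivAt_slack {T₀ θ u0 : ℝ → ℝ} (hd : ∀ τ, HasDerivAt T₀ (u0 (T₀ τ)) τ) (h1 : ∀ t, 1 ≤ u0 t)
    (hθc : Continuous θ) (hTθ : ∀ t, T₀ (θ t) = t) (t : ℝ) :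
    HasDerivAt (fun t ↦ t - θ t) (1 - (u0 t)⁻¹) t := by
  have h := hasDerivAt_labClock (T₀' := fun τ ↦ u0 (T₀ τ)) hd (fun τ ↦ h1 _) hθc hTθ t
  simp only [hTθ] at h
  exact (hasDerivAt_id t).sub h

/-- The slack rate dominates the modulus: `γ⁻¹ (u − 1) ≤ 1 − u⁻¹` for `1 ≤ u ≤ γ`. [folklore] -/
theorem inv_mul_sub_one_le_one_sub_inv {u γ : ℝ} (h1 : 1 ≤ u) (huγ : u ≤ γ) :
    γ⁻¹ * (u - 1) ≤ 1 - u⁻¹ := by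
  have hu : 0 < u := one_pos.trans_le h1
  have hγ : 0 < γ := hu.trans_le huγ
  rw [show 1 - u⁻¹ = (u - 1) / u by field_simp, div_eq_inv_mul]
  exact mul_le_mul_of_nonneg_right ((inv_le_inv₀ hγ hu).mpr huγ) (by linarith)

end Summit.FinalStateConjecture.FinalStateConjecture.Theorems
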